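import Literature.AnabelianGeometry.SemiGraphs.FiniteEtaleCoveringCompPieces
import Literature.AnabelianGeometry.SemiGraphs.FiniteEtaleCoveringOfIso

/-!
# The constituent clause of a composite finite étale covering at a label named inside a
# section-map piece ([SemiAnbd] Def. 2.2 (i), p. 23)

Mochizuki, *Semi-graphs of anabelioids*, Publ. RIMS **42** (2006) 221–322, §2, Def. 2.2 (i), author's
manuscript p. 23 [cite: MochizukiSemiAnbd2006, Def. 2.2(i) p.23]: "`𝒢′_{v′}` is the anabelioid `(𝒢_v)_P`"
— in the cell's local description `Hom.IsFiniteEtaleCoveringOf` the clause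
`∃ α, α.IsEquivalence ∧ φ_{v′}^* ≅ (P × −) ⋙ α`.

PROOF-ONLY (abc-iut cell, layer L3; FACT-LIST row F-1478 `remark_2_4_1_covering`, residual (L), brick
(L-S) of `HOME/staging/w5/w5-d041-g3/L-LOCAL-CLAUSE-DECOMPOSITION.md`; seat abc-iut-w5-d041).  For a
composite `𝒢 → ℋ → 𝒦` the constituent functor at a vertex `v ↦ w ↦ u` is `ψ_w^* ⋙ φ_v^*` with
`ψ_w^* ≅ (P × −) ⋙ α_w` and `φ_v^* ≅ (K × −) ⋙ α′_v` for the label `K ⊆ B_w` of `v`; the composite's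
label is abc-iut-L3-t1's `componentIn` of `K` read back through `α_w` inside the section-map piece
`Y ≅ P ×_{σ_w} X_u` (`FiniteEtaleCoveringCompPieces`), after transporting `K` along the identification
`j : α_w Y ≅ B_w` (a counit).  This file records the resulting constituent clause and the transport of
labels along `j`:

* `sigma_componentMapIso_bijective` — `(i, K) ↦ (i, componentMapIso (j i)⁻¹ K)` is a bijection;
* `exists_equiv_comp_star_componentIn` — **`F ⋙ G ≅ (componentIn K′ × −) ⋙ α″` for an equivalence
  `α″`**, whenever `F ≅ (P × −) ⋙ α`, `G ≅ (K × −) ⋙ α′`, `K′ := componentMapIso j⁻¹ K`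
  (`exists_sliceEquiv_componentIn` of `ComponentsReadBack`, `nonempty_starMapIso`).

Pure category theory: no definition of a notion, no `Prop` fact; nothing here takes a side on
[IUTchIII] Cor. 3.12; typed ≠ proved for F-1478.
-/

namespace Literature.AnabelianGeometry.SemiGraphs

open CategoryTheory CategoryTheory.Limits CategoryTheory.PreGaloisCategory
open Literature.AnabelianGeometry.Anabelioids

universe v₁ v₂ v₃ u₁ u₂ u₃ w₁ w₂

-- Mathlib's `Over.pullback` / `Over.post` simp lemmas only fire under the pre-v4.2x defeq transparency
-- behaviour, exactly as in `Mathlib/CategoryTheory/Comma/Over/Pullback.lean` (also: `π₀Obj` coercions).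
set_option backward.isDefEq.respectTransparency false

/-! ### Transport of labels along the identifications `j i : α (Y i) ≅ B i` -/

section Transport

variable {ι : Type w₁} (D : ι → Type u₂) [∀ i, Category.{v₂} (D i)] (Y' B : ∀ i, D i)
  (j : ∀ i, Y' i ≅ B i)

/-- `(i, K) ↦ (i, K ↪ B i ⥲ Y′ i)` is a bijection `Σ i, π₀(B i) → Σ i, π₀(Y′ i)`.
[cite: MochizukiSemiAnbd2006, Def. 2.2(i) p.23] -/
theorem sigma_componentMapIso_bijective :
    Function.Bijective (fun q : (Σ i, π₀Obj (B i)) =>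
      (⟨q.1, componentMapIso (j q.1).symm q.2⟩ : Σ i, π₀Obj (Y' i))) :=
  (Equiv.sigmaCongrRight fun i => Equiv.ofBijective (componentMapIso (j i).symm)
    ⟨componentMapIso_injective _, componentMapIso_surjective _⟩).bijective

end Transport

/-! ### The constituent clause at a label named inside a piece -/

section Slice

variable {C : Type u₁} [Category.{v₁} C] [GaloisCategory C] {D : Type u₂} [Category.{v₂} D]
  [HasBinaryProducts D] {E : Type u₃} [Category.{v₃} E]
  {P A' Z : C} (σ : P ⟶ A') (g : Z ⟶ A') [Mono σ] (α : Over P ⥤ D) [α.IsEquivalence]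
  (Y : Over P) (ε : Y ≅ OverStar.pullbackObj σ g) {Bw : D} (j : α.obj Y ≅ Bw) (K : π₀Obj Bw)

/-- **The constituent clause of a composite at the label named by `K`.**  If `F ≅ (P × −) ⋙ α` (the
lower covering at `w`, locally) and `G ≅ (K × −) ⋙ α′` (the upper covering at `v`, locally, `K ⊆ B_w` its
label), then `F ⋙ G ≅ (K″ × −) ⋙ α″` for an equivalence `α″`, where `K″ ⊆ Z` is the component named by
`K ↪ B_w ⥲ α Y` inside the piece `Y ≅ P ×_σ Z`. [cite: MochizukiSemiAnbd2006, Def. 2.2(i) p.23] -/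
theorem exists_equiv_comp_star_componentIn (F : C ⥤ D) (eF : F ≅ Over.star P ⋙ α) (G : D ⥤ E)
    (α' : Over (K.1 : D) ⥤ E) [α'.IsEquivalence] (eG : G ≅ Over.star (K.1 : D) ⋙ α') :
    haveI : Mono (ε.hom.left ≫ pullback.snd σ g) := mono_isoHomLeft_comp_pullbackSnd σ g Y ε
    ∃ α'' : Over ((componentIn α Y (ε.hom.left ≫ pullback.snd σ g) (componentMapIso j.symm K)).1 : C) ⥤ E,
      α''.IsEquivalence ∧ Nonempty (F ⋙ G ≅ Over.star _ ⋙ α'') := by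
  haveI : Mono (ε.hom.left ≫ pullback.snd σ g) := mono_isoHomLeft_comp_pullbackSnd σ g Y ε
  obtain ⟨E₀, hE₀, ⟨η⟩⟩ :=
    exists_sliceEquiv_componentIn α Y (ε.hom.left ≫ pullback.snd σ g) (componentMapIso j.symm K)
  haveI := hE₀
  -- the underlying objects of `K` and of its transport `K ↪ B_w ⥲ α Y` are isomorphic
  let i : (K.1 : D) ≅ ((componentMapIso j.symm K).1 : D) :=
    (Subobject.underlyingIso (K.1.arrow ≫ j.symm.hom)).symm
  obtain ⟨τ⟩ := nonempty_starMapIso i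
  refine ⟨E₀ ⋙ (Over.mapIso i).inverse ⋙ α', inferInstance, ⟨?_⟩⟩
  exact Functor.isoWhiskerRight eF G ≪≫ Functor.isoWhiskerLeft (Over.star P ⋙ α) eG ≪≫
    Functor.isoWhiskerLeft (Over.star P ⋙ α)
      (Functor.isoWhiskerRight ((Over.star (K.1 : D)).rightUnitor.symm ≪≫
        Functor.isoWhiskerLeft (Over.star (K.1 : D)) (Over.mapIso i).unitIso ≪≫
        Functor.isoWhiskerRight τ (Over.mapIso i).inverse) α') ≪≫
    (Functor.isoWhiskerRight η ((Over.mapIso i).inverse ⋙ α') :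
      (Over.star P ⋙ α) ⋙ Over.star _ ⋙ (Over.mapIso i).inverse ⋙ α' ≅
        (Over.star _ ⋙ E₀) ⋙ (Over.mapIso i).inverse ⋙ α')

end Slice

end Literature.AnabelianGeometry.SemiGraphs
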